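/-
Copyright (c) 2026. All rights reserved.
Released under Apache 2.0 license as described in the file LICENSE.
-/
import Literature.Probability.FitznerVanDerHofstad2017.NobleBoundsNMidS
import HarnessLib

/-!
# NoBLE N-bounds — a middle junction whose UPPER level is closed (`a_{k+1} = ★`)

Infrastructure twins of `NobleBoundsNMidS` §B for the kind `closed` (the upper level `k + 1` of a junction
`k` whose successor junction `k + 1` is special, i.e. `a (k+1) = ★`): the closed-form view, its line table
`v → t`, `t → z`, `t → u′`, `z → u′`, the connection / canonical / vacancy clauses, and the active-slot lemma.
[cite: FitznerVanDerHofstad2017, (4.58), (4.62) (arXiv:1506.07977v2 p. 41)]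
-/

namespace Literature.Probability.FitznerVanDerHofstad2017

open Literature.Barriers.CriticalPhenomena Literature.Probability.Percolation
open Literature.Probability.LatticeModels Literature.Combinatorics.SimpleGraph _root_.SimpleGraph
open _root_.MeasureTheory
open Literature.Probability.FitznerVanDerHofstad2017.NobleBlocks
open Literature.Probability.FitznerVanDerHofstad2017.NobleBlocks.LenIdx
open scoped ENNReal

variable {d : ℕ}

/-! ### A. The closed upper level in closed form -/

section ClosedU

variable (M : ℕ) (x : Site d) (b : Fin (M + 2) → Site d × Site d) (w t z : Fin (M + 2) → Site d)
  (a : Fin (M + 2) → Fin 3 ⊕ Unit) (τ : Fin (M + 1) → Bool × Fin 3)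

/-- The middle level `k + 1` over a SPECIAL successor junction (kind `closed`), in closed form (either variant bit).
[cite: FitznerVanDerHofstad2017, (4.58), (4.62) (arXiv:1506.07977v2 p. 41)] -/
theorem pieceViews_closedU (i : Fin (M + 1)) {u₀ : Unit} (ha' : a i.succ = Sum.inr u₀) :
    pieceViews M x b w t z a τ i.castSucc.succ =
      ⟨.closed, (b i.castSucc).1, (b i.castSucc).2, t i.castSucc, z i.castSucc, (b i.succ).1, (b i.succ).2,
        w i.succ, z i.succ, bondsAt {(b i.castSucc).1} ∪ {s((b i.succ).1, (b i.succ).2)}⟩ := by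
  rw [pieceViews_mid, ha']; rfl

/-- The lines of a closed level `k + 1`: `v → t`, `t ⇔ z`, `t → u′`, `z → u′` (slots `4`, `5` trivial) ((4.58)).
[cite: FitznerVanDerHofstad2017, (4.58), (4.62) (arXiv:1506.07977v2 p. 41)] -/
theorem pieceViews_closedU_line (i : Fin (M + 1)) {u₀ : Unit} (ha' : a i.succ = Sum.inr u₀) (j : Fin 6) :
    (pieceViews M x b w t z a τ i.castSucc.succ).line j =
      ![((b i.castSucc).2, t i.castSucc), (t i.castSucc, z i.castSucc), (t i.castSucc, (b i.succ).1),
        (z i.castSucc, (b i.succ).1), ((b i.castSucc).2, (b i.castSucc).2),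
        ((b i.castSucc).2, (b i.castSucc).2)] j := by
  rw [pieceViews_closedU M x b w t z a τ i ha']; rfl

/-- At a junction `k ≤ M` over a closed upper level, the upper line `up j` is active iff `j < 4`.
[cite: FitznerVanDerHofstad2017, (4.58), (4.62) (arXiv:1506.07977v2 p. 41)] -/
theorem jClosedU_act_up_iff (i : Fin (M + 1)) {u₀ : Unit} (ha' : a i.succ = Sum.inr u₀)
    (uB uT : Bool) (j : Fin 6) : (jctx M x b w t z a τ i.castSucc).Act uB uT (.up j) ↔ (j : ℕ) < 4 := by
  rw [jMid_act_up_iff, ha']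
  have hk : midKind (Sum.inr u₀ : Fin 3 ⊕ Unit).isRight (τ i).1 = .closed := rfl
  rw [hk]
  show j ≠ 5 ∧ ¬ (4 ≤ (j : ℕ)) ↔ (j : ℕ) < 4
  have := j.isLt
  constructor
  · rintro ⟨-, h⟩; omega
  · intro h; refine ⟨?_, by omega⟩
    intro h5; rw [h5] at h; exact absurd h (by decide)

end ClosedU

/-! ### B. Facts of a closed upper level -/

section ClosedUFacts

variable {M : ℕ} {x : Site d} {b : Fin (M + 2) → Site d × Site d} {w t z : Fin (M + 2) → Site d}
  {a : Fin (M + 2) → Fin 3 ⊕ Unit} {c : Fin 3 ⊕ Unit} {τ : Fin (M + 1) → Bool × Fin 3}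
  {ω : Fin (M + 3) → BondConfig (Site d)} {K₀ : Fin (M + 3) → Fin 6 → Set (Sym2 (Site d))}

namespace JFacts

/-- The witnesses of a closed level `k + 1` witness its four lines `v → t`, `t ⇔ z`, `t → u′`, `z → u′`.
[cite: FitznerVanDerHofstad2017, (4.58), (4.62) (arXiv:1506.07977v2 p. 41)] -/
theorem conn_closedU (h : JFacts M x b w t z a c τ ω K₀) (i : Fin (M + 1)) {u₀ : Unit}
    (ha' : a i.succ = Sum.inr u₀) :
    K₀ i.castSucc.succ 0 ∈ (openConn (b i.castSucc).2 (t i.castSucc) : Set (BondConfig (Site d))) ∧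
    K₀ i.castSucc.succ 1 ∈ (openConn (t i.castSucc) (z i.castSucc) : Set (BondConfig (Site d))) ∧
    K₀ i.castSucc.succ 2 ∈ (openConn (t i.castSucc) (b i.succ).1 : Set (BondConfig (Site d))) ∧
    K₀ i.castSucc.succ 3 ∈ (openConn (z i.castSucc) (b i.succ).1 : Set (BondConfig (Site d))) := by
  have h0 := h.conn i.castSucc.succ 0
  have h1 := h.conn i.castSucc.succ 1
  have h2 := h.conn i.castSucc.succ 2
  have h3 := h.conn i.castSucc.succ 3
  rw [pieceViews_closedU_line M x b w t z a τ i ha'] at h0 h1 h2 h3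
  exact ⟨h0, h1, h2, h3⟩

/-- The canonical clause of a closed level `k + 1`: `t_k = u_{k+1} ↔ z_k = u_{k+1}` (a trivial last sausage sits
AT the pin). [cite: FitznerVanDerHofstad2017, (4.58) "{z = x ⟺ t = x}", (4.62) (arXiv:1506.07977v2 p. 41)] -/
theorem canon_closedU (h : JFacts M x b w t z a c τ ω K₀) (i : Fin (M + 1)) {u₀ : Unit}
    (ha' : a i.succ = Sum.inr u₀) : (t i.castSucc = (b i.succ).1 ↔ z i.castSucc = (b i.succ).1) := by
  have hc := (h.level i.castSucc.succ).1
  rw [pieceViews_closedU M x b w t z a τ i ha'] at hc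
  exact hc

/-- The vacancy clause of a closed level `k + 1`: `u_k ∉ {t_k, z_k, u_{k+1}}`.
[cite: FitznerVanDerHofstad2017, (4.58) "b̲ ∉ …", (4.62) (arXiv:1506.07977v2 p. 41)] -/
theorem vac_closedU (h : JFacts M x b w t z a c τ ω K₀) (i : Fin (M + 1)) {u₀ : Unit}
    (ha' : a i.succ = Sum.inr u₀) :
    (b i.castSucc).1 ∉ ({t i.castSucc, z i.castSucc, (b i.succ).1} : Set (Site d)) := by
  have hv := (h.level i.castSucc.succ).2.1
  rw [pieceViews_closedU M x b w t z a τ i ha'] at hv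
  exact hv

/-- On a closed level with a non-trivial sausage class (`t_k ≠ z_k`) neither endpoint is the pin:
`t_k ≠ u_{k+1}` and `z_k ≠ u_{k+1}` — the facts `canon_midS` gives on an open level.
[cite: FitznerVanDerHofstad2017, (4.58), (4.62) (arXiv:1506.07977v2 p. 41)] -/
theorem ne_pin_closedU (h : JFacts M x b w t z a c τ ω K₀) (i : Fin (M + 1)) {u₀ : Unit}
    (ha' : a i.succ = Sum.inr u₀) (htz : t i.castSucc ≠ z i.castSucc) :
    z i.castSucc ≠ (b i.succ).1 ∧ t i.castSucc ≠ (b i.succ).1 := by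
  have hc := canon_closedU h i ha'
  constructor
  · intro hz; exact htz ((hc.2 hz).trans hz.symm)
  · intro ht; exact htz (ht.trans (hc.1 ht).symm)

end JFacts

end ClosedUFacts

end Literature.Probability.FitznerVanDerHofstad2017
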